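import Summits.QuantumFields.YangMills.Theorems.UnitScaleTiltProp7TorusGreenKernelRows
import Summits.QuantumFields.YangMills.Theorems.UnitScaleTiltProp7TorusGreenConvolutionDecay
import HarnessLib

/-!
# Route `UnitScaleTilt`, crux K1 «MinimiserStabilityRegPr» (stmt-QuantumFields-19200), route-R E′ path (α′), (E1-b)-cov (N-cov) FLAT-CONV kernel instances, FILE K2: THE SIX GREEN-KERNEL
# CONVOLUTION BOUNDS — FILE K1's rows ✓p674845 (`…TorusGreenKernelRows`, K-1…K-6, pole included) fed to ★routeR-w3 g6's engine ✓p673901∕✓p674389 (`conv_bdd_le`, `conv_lin_le`, `conv_inv_le`,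
# `conv_inv_sq_le`): for weights `0 ≤ w ≤ A∕(1∨tdist(·,y₀))²` supported in the `R`-ball at `y₀` and a kernel centre `x` with `tdist(x,y₀) ≤ 2R`, the sums `Σ_z |𝒦(EK z − EK x)|·w z` are bounded by
# routeR-w6 g6's four shapes `C·A·{R, R(R + tdist x y₀), √(3R∕(1∨tdist x y₀)), (1∨tdist x y₀)⁻¹}` with ABSOLUTE `C` (`P.d = 3`)

Cell `ym3-torus`, D-0154 (3c) twin-width seat `ym-ust-19200-w8` (gen 7); ★routeR-w3 g6 word (12) 22:28:29Z «then one `exact conv_…` per row gives routeR-w6's four shapes with explicit `C`».  THEOREMS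
ONLY (0 `def`, 0 `sorry`); `G̃₂` via the displayed definition hypothesis `hG` on the finest torus; `--supports stmt-QuantumFields-19200`, count-neutral.  YM₃ on T³ is a ladder rung (R3), not the
Clay problem; nothing here claims the stub, the crux, d = 4 or the gap.

WHAT IS PROVED (ns `…Theorems.Prop7TorusGreenConvolutionRows`; all `∃ C, 0 ≤ C ∧ ∀ P (hd : P.d = 3) k hk … y₀ x R w A (engine hypotheses) …`, `t z := EK hk z − EK hk x`).
* ★★ `conv_green_le` (K-1 ∘ `conv_inv_le`: `Σ|G̃₁ t|·w ≤ C·A·√(3R∕(1∨tdist x y₀))`), ★★ `conv_green_grad_le` (K-2 ∘ `conv_inv_sq_le`: `≤ C·A∕(1∨tdist x y₀)`),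
  ★ `conv_green2_grad_le` (K-3 ∘ `conv_bdd_le`: `≤ C·A·(8 + 192R)`), ★★ `conv_green2_hessian_le` (K-4 ∘ `conv_inv_le`), ★★ `conv_green2_thirdDiff_le` (K-5 ∘ `conv_inv_sq_le`),
  ★★ `conv_green2_sub_zero_le` (K-6 ∘ `conv_lin_le`: `≤ C·A·((1 + tdist x y₀)(8 + 192R) + (8 + 128R²))`); vector densities via ✓ `norm_sum_smul_le_of_conv`.
HONEST SCOPE.  Helper lattice lemmas (bookkeeping only); no Yang–Mills statement is touched.
References: Lawler–Limic, *Random Walk: A Modern Introduction* (2010) Thm 4.3.1 [LawlerLimic2010]; Bałaban, CMP 95 (1984) (1.17) p.20 [Balaban1984PropagatorsI].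
-/

set_option autoImplicit false

noncomputable section

open scoped BigOperators
open Finset

namespace Summit.QuantumFields.YangMills.Theorems.Prop7TorusGreenConvolutionRows

open Literature.MathematicalPhysics.QuantumFieldTheory.Balaban1983to89
open B5Prop11Plancherel (Tor fine)
open B5Eq117TorusCarriers (Mk EK)
open Literature.Probability.LatticeModels (torusGreen TorusSite latticeMomentum dispersion)
open Prop7TorusGreenKernelRows Prop7TorusGreenConvolution Prop7TorusGreenConvolutionDecay

/-- ★★ **(K-1) ∘ `conv_inv_le`**: the SIZE kernel `G̃₁(EK z − EK x)` against an `R`-ball weight `≤ A∕(1∨tdist)²` at `y₀`, centre `x` with `tdist x y₀ ≤ 2R`, `R ≥ 1`: `Σ_z|G̃₁|·w ≤ 1500c·A·√(3R∕(1∨tdist x y₀))`. [folklore] -/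
theorem conv_green_le : ∃ C : ℝ, 0 ≤ C ∧ ∀ (P : Params) (hd : P.d = 3) (k : ℕ) (hk : k ≤ P.m + P.K)
    (y₀ x : Site P 0) (R : ℕ), 1 ≤ R → Site.tdist x y₀ ≤ 2 * R → ∀ (w : Site P 0 → ℝ) (A : ℝ), 0 ≤ A → (∀ z, 0 ≤ w z) →
      (∀ z, w z ≤ A / (max 1 ((Site.tdist z y₀ : ℕ) : ℝ)) ^ 2) → (∀ z, R < Site.tdist z y₀ → w z = 0) →
      ∑ z, |torusGreen (L := P.L ^ k * P.sitesPerDir k) (EK hk z - EK hk x)| * w z ≤ C * A * Real.sqrt (3 * (R : ℝ) / max 1 ((Site.tdist x y₀ : ℕ) : ℝ)) := by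
  obtain ⟨c, hc, h⟩ := abs_green_EK_le
  refine ⟨1500 * c, by positivity, ?_⟩
  intro P hd k hk y₀ x R hR hx w A hA hw hwA hw0
  have hmain := conv_inv_le y₀ x R (fun z => torusGreen (L := P.L ^ k * P.sitesPerDir k) (EK hk z - EK hk x)) w hd hR hx hc hA
    (fun z => h P hd k hk x z ) hw hwA hw0
  calc _ ≤ _ := hmain
    _ = 1500 * c * A * Real.sqrt (3 * (R : ℝ) / max 1 ((Site.tdist x y₀ : ℕ) : ℝ)) := by ring

/-- ★★ **(K-2) ∘ `conv_inv_sq_le`**: the GRADIENT kernel `G̃₁(EK z − EK x + eᵢ) − G̃₁(EK z − EK x)`: `Σ_z|∇G̃₁|·w ≤ 3136c·A∕(1∨tdist x y₀)`. [folklore] -/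
theorem conv_green_grad_le : ∃ C : ℝ, 0 ≤ C ∧ ∀ (P : Params) (hd : P.d = 3) (k : ℕ) (hk : k ≤ P.m + P.K)
    (i : Fin P.d) (y₀ x : Site P 0) (R : ℕ), Site.tdist x y₀ ≤ 2 * R → ∀ (w : Site P 0 → ℝ) (A : ℝ), 0 ≤ A → (∀ z, 0 ≤ w z) →
      (∀ z, w z ≤ A / (max 1 ((Site.tdist z y₀ : ℕ) : ℝ)) ^ 2) → (∀ z, R < Site.tdist z y₀ → w z = 0) →
      ∑ z, |torusGreen (L := P.L ^ k * P.sitesPerDir k) ((EK hk z - EK hk x) + Pi.single i 1) - torusGreen (L := P.L ^ k * P.sitesPerDir k) (EK hk z - EK hk x)| * w z ≤ C * A * (max 1 ((Site.tdist x y₀ : ℕ) : ℝ))⁻¹ := by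
  obtain ⟨c, hc, h⟩ := abs_green_grad_EK_le
  refine ⟨3136 * c, by positivity, ?_⟩
  intro P hd k hk i y₀ x R hx w A hA hw hwA hw0
  have hmain := conv_inv_sq_le y₀ x R (fun z => torusGreen (L := P.L ^ k * P.sitesPerDir k) ((EK hk z - EK hk x) + Pi.single i 1) - torusGreen (L := P.L ^ k * P.sitesPerDir k) (EK hk z - EK hk x)) w hd hx hc hA
    (fun z => h P hd k hk x z i) hw hwA hw0
  calc _ ≤ _ := hmain
    _ = 3136 * c * A * (max 1 ((Site.tdist x y₀ : ℕ) : ℝ))⁻¹ := by ring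

/-- ★ **(K-3) ∘ `conv_bdd_le`**: the bounded kernel `∇G̃₂(EK z − EK x)`: `Σ_z|∇G̃₂|·w ≤ c·A·(8 + 192R)`. [folklore] -/
theorem conv_green2_grad_le : ∃ C : ℝ, 0 ≤ C ∧ ∀ (P : Params) (hd : P.d = 3) (k : ℕ) (hk : k ≤ P.m + P.K)
    (G : TorusSite P.d (P.L ^ k * P.sitesPerDir k) → ℝ),
    (∀ t : TorusSite P.d (P.L ^ k * P.sitesPerDir k),
      G t = (∑ q ∈ (univ : Finset (TorusSite P.d (P.L ^ k * P.sitesPerDir k))).erase 0,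
        Real.cos (∑ i, latticeMomentum (P.L ^ k * P.sitesPerDir k) q i * ((t i).val : ℝ))
          / dispersion (latticeMomentum (P.L ^ k * P.sitesPerDir k) q) ^ 2)
        / (((P.L ^ k * P.sitesPerDir k : ℕ) : ℝ)) ^ P.d) →
    ∀ (i : Fin P.d),
    ∀ (y₀ x : Site P 0) (R : ℕ), ∀ (w : Site P 0 → ℝ) (A : ℝ), 0 ≤ A → (∀ z, 0 ≤ w z) →
      (∀ z, w z ≤ A / (max 1 ((Site.tdist z y₀ : ℕ) : ℝ)) ^ 2) → (∀ z, R < Site.tdist z y₀ → w z = 0) →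
      ∑ z, |G ((EK hk z - EK hk x) + Pi.single i 1) - G (EK hk z - EK hk x)| * w z ≤ C * A * (8 + 192 * (R : ℝ)) := by
  obtain ⟨c, hc, h⟩ := abs_green2_grad_EK_le
  refine ⟨1 * c, by positivity, ?_⟩
  intro P hd k hk G hG i y₀ x R w A hA hw hwA hw0
  have hmain := conv_bdd_le y₀ R (fun z => G ((EK hk z - EK hk x) + Pi.single i 1) - G (EK hk z - EK hk x)) w hd hc hA
    (fun z => h P hd k hk G hG x z i) hw hwA hw0
  calc _ ≤ _ := hmain
    _ = 1 * c * A * (8 + 192 * (R : ℝ)) := by ring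

/-- ★★ **(K-4) ∘ `conv_inv_le`**: the HESSIAN kernel `∇ᵢ⁺∇ⱼ⁻G̃₂(EK z − EK x)`: `Σ_z|∇²G̃₂|·w ≤ 1500c·A·√(3R∕(1∨tdist x y₀))` (`R ≥ 1`). [folklore] -/
theorem conv_green2_hessian_le : ∃ C : ℝ, 0 ≤ C ∧ ∀ (P : Params) (hd : P.d = 3) (k : ℕ) (hk : k ≤ P.m + P.K)
    (G : TorusSite P.d (P.L ^ k * P.sitesPerDir k) → ℝ),
    (∀ t : TorusSite P.d (P.L ^ k * P.sitesPerDir k),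
      G t = (∑ q ∈ (univ : Finset (TorusSite P.d (P.L ^ k * P.sitesPerDir k))).erase 0,
        Real.cos (∑ i, latticeMomentum (P.L ^ k * P.sitesPerDir k) q i * ((t i).val : ℝ))
          / dispersion (latticeMomentum (P.L ^ k * P.sitesPerDir k) q) ^ 2)
        / (((P.L ^ k * P.sitesPerDir k : ℕ) : ℝ)) ^ P.d) →
    ∀ (i j : Fin P.d),
    ∀ (y₀ x : Site P 0) (R : ℕ), 1 ≤ R → Site.tdist x y₀ ≤ 2 * R → ∀ (w : Site P 0 → ℝ) (A : ℝ), 0 ≤ A → (∀ z, 0 ≤ w z) →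
      (∀ z, w z ≤ A / (max 1 ((Site.tdist z y₀ : ℕ) : ℝ)) ^ 2) → (∀ z, R < Site.tdist z y₀ → w z = 0) →
      ∑ z, |G ((EK hk z - EK hk x) + Pi.single i 1) - G ((EK hk z - EK hk x) + Pi.single i 1 - Pi.single j 1) - G (EK hk z - EK hk x) + G ((EK hk z - EK hk x) - Pi.single j 1)| * w z ≤ C * A * Real.sqrt (3 * (R : ℝ) / max 1 ((Site.tdist x y₀ : ℕ) : ℝ)) := by
  obtain ⟨c, hc, h⟩ := abs_green2_hessian_EK_le
  refine ⟨1500 * c, by positivity, ?_⟩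
  intro P hd k hk G hG i j y₀ x R hR hx w A hA hw hwA hw0
  have hmain := conv_inv_le y₀ x R (fun z => G ((EK hk z - EK hk x) + Pi.single i 1) - G ((EK hk z - EK hk x) + Pi.single i 1 - Pi.single j 1) - G (EK hk z - EK hk x) + G ((EK hk z - EK hk x) - Pi.single j 1)) w hd hR hx hc hA
    (fun z => h P hd k hk G hG x z i j) hw hwA hw0
  calc _ ≤ _ := hmain
    _ = 1500 * c * A * Real.sqrt (3 * (R : ℝ) / max 1 ((Site.tdist x y₀ : ℕ) : ℝ)) := by ring

/-- ★★ **(K-5) ∘ `conv_inv_sq_le`**: the THIRD-DIFFERENCE kernel `∇ᵢ⁺∇ⱼ⁻G̃₂(t) − ∇ᵢ⁺∇ⱼ⁻G̃₂(t − e_{k'})`, `t = EK z − EK x`: `Σ_z|∇³G̃₂|·w ≤ 3136c·A∕(1∨tdist x y₀)`. [folklore] -/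
theorem conv_green2_thirdDiff_le : ∃ C : ℝ, 0 ≤ C ∧ ∀ (P : Params) (hd : P.d = 3) (k : ℕ) (hk : k ≤ P.m + P.K)
    (G : TorusSite P.d (P.L ^ k * P.sitesPerDir k) → ℝ),
    (∀ t : TorusSite P.d (P.L ^ k * P.sitesPerDir k),
      G t = (∑ q ∈ (univ : Finset (TorusSite P.d (P.L ^ k * P.sitesPerDir k))).erase 0,
        Real.cos (∑ i, latticeMomentum (P.L ^ k * P.sitesPerDir k) q i * ((t i).val : ℝ))
          / dispersion (latticeMomentum (P.L ^ k * P.sitesPerDir k) q) ^ 2)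
        / (((P.L ^ k * P.sitesPerDir k : ℕ) : ℝ)) ^ P.d) →
    ∀ (i j k' : Fin P.d),
    ∀ (y₀ x : Site P 0) (R : ℕ), Site.tdist x y₀ ≤ 2 * R → ∀ (w : Site P 0 → ℝ) (A : ℝ), 0 ≤ A → (∀ z, 0 ≤ w z) →
      (∀ z, w z ≤ A / (max 1 ((Site.tdist z y₀ : ℕ) : ℝ)) ^ 2) → (∀ z, R < Site.tdist z y₀ → w z = 0) →
      ∑ z, |(G ((EK hk z - EK hk x) + Pi.single i 1) - G ((EK hk z - EK hk x) + Pi.single i 1 - Pi.single j 1) - G (EK hk z - EK hk x) + G ((EK hk z - EK hk x) - Pi.single j 1)) - (G ((EK hk z - EK hk x) - Pi.single k' 1 + Pi.single i 1) - G ((EK hk z - EK hk x) - Pi.single k' 1 + Pi.single i 1 - Pi.single j 1) - G ((EK hk z - EK hk x) - Pi.single k' 1) + G ((EK hk z - EK hk x) - Pi.single k' 1 - Pi.single j 1))| * w z ≤ C * A * (max 1 ((Site.tdist x y₀ : ℕ) : ℝ))⁻¹ := by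
  obtain ⟨c, hc, h⟩ := abs_green2_thirdDiff_EK_le
  refine ⟨3136 * c, by positivity, ?_⟩
  intro P hd k hk G hG i j k' y₀ x R hx w A hA hw hwA hw0
  have hmain := conv_inv_sq_le y₀ x R (fun z => (G ((EK hk z - EK hk x) + Pi.single i 1) - G ((EK hk z - EK hk x) + Pi.single i 1 - Pi.single j 1) - G (EK hk z - EK hk x) + G ((EK hk z - EK hk x) - Pi.single j 1)) - (G ((EK hk z - EK hk x) - Pi.single k' 1 + Pi.single i 1) - G ((EK hk z - EK hk x) - Pi.single k' 1 + Pi.single i 1 - Pi.single j 1) - G ((EK hk z - EK hk x) - Pi.single k' 1) + G ((EK hk z - EK hk x) - Pi.single k' 1 - Pi.single j 1))) w hd hx hc hA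
    (fun z => h P hd k hk G hG x z i j k') hw hwA hw0
  calc _ ≤ _ := hmain
    _ = 3136 * c * A * (max 1 ((Site.tdist x y₀ : ℕ) : ℝ))⁻¹ := by ring

/-- ★★ **(K-6) ∘ `conv_lin_le`**: the recentred SIZE kernel `G̃₂(EK z − EK x) − G̃₂(0)` (linear growth): `Σ_z|G̃₂ − G̃₂(0)|·w ≤ c·A·((1 + tdist x y₀)(8 + 192R) + (8 + 128R²))`. [folklore] -/
theorem conv_green2_sub_zero_le : ∃ C : ℝ, 0 ≤ C ∧ ∀ (P : Params) (hd : P.d = 3) (k : ℕ) (hk : k ≤ P.m + P.K)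
    (G : TorusSite P.d (P.L ^ k * P.sitesPerDir k) → ℝ),
    (∀ t : TorusSite P.d (P.L ^ k * P.sitesPerDir k),
      G t = (∑ q ∈ (univ : Finset (TorusSite P.d (P.L ^ k * P.sitesPerDir k))).erase 0,
        Real.cos (∑ i, latticeMomentum (P.L ^ k * P.sitesPerDir k) q i * ((t i).val : ℝ))
          / dispersion (latticeMomentum (P.L ^ k * P.sitesPerDir k) q) ^ 2)
        / (((P.L ^ k * P.sitesPerDir k : ℕ) : ℝ)) ^ P.d) →
    ∀ (y₀ x : Site P 0) (R : ℕ), ∀ (w : Site P 0 → ℝ) (A : ℝ), 0 ≤ A → (∀ z, 0 ≤ w z) →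
      (∀ z, w z ≤ A / (max 1 ((Site.tdist z y₀ : ℕ) : ℝ)) ^ 2) → (∀ z, R < Site.tdist z y₀ → w z = 0) →
      ∑ z, |G (EK hk z - EK hk x) - G 0| * w z ≤ C * A * ((1 + ((Site.tdist x y₀ : ℕ) : ℝ)) * (8 + 192 * (R : ℝ)) + (8 + 128 * (R : ℝ) ^ 2)) := by
  obtain ⟨c, hc, h⟩ := abs_green2_sub_zero_EK_le
  refine ⟨1 * c, by positivity, ?_⟩
  intro P hd k hk G hG y₀ x R w A hA hw hwA hw0
  have hmain := conv_lin_le y₀ x R (fun z => G (EK hk z - EK hk x) - G 0) w hd hc hA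
    (fun z => h P hd k hk G hG x z ) hw hwA hw0
  calc _ ≤ _ := hmain
    _ = 1 * c * A * ((1 + ((Site.tdist x y₀ : ℕ) : ℝ)) * (8 + 192 * (R : ℝ)) + (8 + 128 * (R : ℝ) ^ 2)) := by ring

end Summit.QuantumFields.YangMills.Theorems.Prop7TorusGreenConvolutionRows
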